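import Summits.CriticalPhenomena.PercolationContinuityZ3.Theorems.PercNearOneGluingNoHeavyLowerTailSunflowerMultiPetalLocalMatching
import HarnessLib
import HarnessLib.Audit

/-!
# `NoHeavyLowerTail` (crux stmt-CriticalPhenomena-4575), abstract sunflower cubic, `k` petals: REFUTATION of the fixed-spectator local matching
# `LocalMatchingK` (…SunflowerMultiPetalLocalMatching) by the six-point 'three OR-pairs' sunflower (co-star(2,2,2))

Support file (seat `prim-l12-p2` gen 27; `--supports stmt-CriticalPhenomena-4575`; COMPUTATIONAL: one `native_decide` for a cardinality on 6 points).  Memo: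
run/shared/lean/prim/prim-l12/prim-l12-p2/FINDING-g27-EXHAUSTIVE-N6-AND-FORMS.md §4.6.  Found by the EXHAUSTIVE six-point census of the same session (kit j175070: the unique
failing class up to `S₆` among 4 824 140 739 instances); the doubled-cube form `DoubledCubeHallK` of the same file holds on this instance and everywhere tested.

THE WITNESS (`csF : MSunflower 3 (Fin 6)`).  Pairs `p₀ = {0,1}`, `p₁ = {2,3}`, `p₂ = {4,5}`; a set HITS a pair if it meets it.  Petal up-sets `V 0 = hits p₀ ∧ hits p₁`,
`V 1 = hits p₀ ∧ hits p₂`, `V 2 = hits p₁ ∧ hits p₂`, kernel `A = hits all three` (so: bottom = hits ≤ 1 pair, petal `{i,j}` = hits exactly the pairs `i, j`, three components).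
It has 45 slots and 38 unordered demands (30 antipodal bads with decided spectator, 8 rainbows), i.e. `#badParts = 228` ordered bads, but the slots adjacent (`LMAdj`) to SOME bad
form a family `csN` of only 37 (`6 · 37 = 222 < 228`), so no injective `LMAdj`-respecting `ψ : badParts → slotParts × Fin 6` exists.

* `not_localMatchingK : ¬ LocalMatchingK`.
-/

set_option maxRecDepth 100000

namespace Summit.CriticalPhenomena.PercolationContinuityZ3.Theorems.SunflowerPartition

open Finset

namespace LocalMatchingRefutation

/-- The three pairs `{0,1}, {2,3}, {4,5}` of `Fin 6`. [this work] -/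
def pair (p : Fin 3) : Finset (Fin 6) := ![{0, 1}, {2, 3}, {4, 5}] p

/-- Hitting a pair (`(S ∩ pair p).Nonempty`) is monotone in `S`. [this work] -/
theorem hits_mono {p : Fin 3} {S T : Finset (Fin 6)} (hST : S ⊆ T) (h : (S ∩ pair p).Nonempty) : (T ∩ pair p).Nonempty := by
  obtain ⟨x, hx⟩ := h
  exact ⟨x, by rw [mem_inter] at hx ⊢; exact ⟨hST hx.1, hx.2⟩⟩

/-- The two pairs hit by petal `i`: `V 0 ↔ (p₀,p₁)`, `V 1 ↔ (p₀,p₂)`, `V 2 ↔ (p₁,p₂)`. [this work] -/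
def fstPair (i : Fin 3) : Fin 3 := ![0, 0, 1] i
/-- See `fstPair`. [this work] -/
def sndPair (i : Fin 3) : Fin 3 := ![1, 2, 2] i

/-- Petal up-set table (three closed terms, so that compiled evaluation computes each family once). [this work] -/
def csV0 : Finset (Finset (Fin 6)) := univ.filter fun S => (S ∩ pair 0).Nonempty ∧ (S ∩ pair 1).Nonempty
/-- See `csV0`. [this work] -/
def csV1 : Finset (Finset (Fin 6)) := univ.filter fun S => (S ∩ pair 0).Nonempty ∧ (S ∩ pair 2).Nonempty
/-- See `csV0`. [this work] -/
def csV2 : Finset (Finset (Fin 6)) := univ.filter fun S => (S ∩ pair 1).Nonempty ∧ (S ∩ pair 2).Nonempty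

/-- Petal up-set `V i` = the sets hitting both pairs of `i`. [this work] -/
def csV (i : Fin 3) : Finset (Finset (Fin 6)) := ![csV0, csV1, csV2] i

/-- `csV i` unfolded. [this work] -/
theorem csV_eq (i : Fin 3) : csV i = univ.filter fun S => (S ∩ pair (fstPair i)).Nonempty ∧ (S ∩ pair (sndPair i)).Nonempty := by
  fin_cases i <;> rfl

/-- Kernel = the sets hitting all three pairs (transversal-containing sets). [this work] -/
def csA : Finset (Finset (Fin 6)) := univ.filter fun S => (S ∩ pair 0).Nonempty ∧ (S ∩ pair 1).Nonempty ∧ (S ∩ pair 2).Nonempty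

/-- The petal up-sets are up-sets. [this work] -/
theorem csV_upper (i : Fin 3) : IsUpperSet ((csV i : Finset (Finset (Fin 6))) : Set (Finset (Fin 6))) := by
  intro S T hST hS
  rw [csV_eq] at hS ⊢
  simp only [coe_filter, mem_univ, true_and, Set.mem_setOf_eq] at hS ⊢
  exact ⟨hits_mono hST hS.1, hits_mono hST hS.2⟩

/-- The kernel is an up-set. [this work] -/
theorem csA_upper : IsUpperSet ((csA : Finset (Finset (Fin 6))) : Set (Finset (Fin 6))) := by
  intro S T hST hS
  simp only [csA, coe_filter, mem_univ, true_and, Set.mem_setOf_eq] at hS ⊢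
  exact ⟨hits_mono hST hS.1, hits_mono hST hS.2.1, hits_mono hST hS.2.2⟩

/-- The kernel lies in every petal up-set. [this work] -/
theorem csA_sub : ∀ i : Fin 3, csA ⊆ csV i := by
  intro i S hS
  rw [csV_eq]
  simp only [csA, mem_filter, mem_univ, true_and] at hS ⊢
  fin_cases i <;> simp only [fstPair, sndPair] <;> tauto

/-- Distinct petal up-sets meet inside the kernel. [this work] -/
theorem csV_inter : ∀ i j : Fin 3, i ≠ j → csV i ∩ csV j ⊆ csA := by
  intro i j hij S hS
  rw [mem_inter, csV_eq, csV_eq] at hS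
  simp only [csA, mem_filter, mem_univ, true_and] at hS ⊢
  fin_cases i <;> fin_cases j <;> simp only [fstPair, sndPair] at hS hij ⊢ <;> first | exact absurd rfl hij | tauto

/-- **The witness**: the six-point 'three OR-pairs' multi-petal sunflower (three petals). [this work] -/
def csF : MSunflower 3 (Fin 6) where
  V := csV
  A := csA
  upperV := csV_upper
  upperA := csA_upper
  A_sub := csA_sub
  inter_sub := csV_inter

/-- Decidability of the local adjacency for the witness (by unfolding the definition). [this work] -/
instance decLMAdj (q s : Finset (Fin 6) × Finset (Fin 6)) : Decidable (csF.LMAdj q s) := by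
  unfold MSunflower.LMAdj; infer_instance

/-- The slots adjacent (`LMAdj`) to at least one bad ordered partition. [this work] -/
def csN : Finset (Finset (Fin 6) × Finset (Fin 6)) :=
  (csF.badParts).biUnion fun q => (csF.slotParts).filter fun s => csF.LMAdj q s

/-- The count: `6 · #csN < #badParts` (`6 · 37 = 222 < 228`; evaluated by compiled code — the only computational step). [this work] -/
theorem six_mul_card_csN_lt : 6 * csN.card < (csF.badParts).card := by native_decide

/-- Abstract pigeonhole: if every slot adjacent to a demand lies in a family `N` with `6·#N < #D`, there is no injective adjacency-respecting `D → Sl × Fin 6`.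
(Stated for arbitrary finsets so that no concrete finset is ever unfolded by the elaborator.) [this work] -/
theorem no_injective_of_small_neighbourhood {β γ : Type*} (D : Finset β) (Sl N : Finset γ) (Adj : β → γ → Prop)
    (hN : ∀ q ∈ D, ∀ s ∈ Sl, Adj q s → s ∈ N) (hlt : 6 * N.card < D.card) :
    ¬ ∃ ψ : ↥D → ↥Sl × Fin 6, Function.Injective ψ ∧ ∀ q, Adj q.1 (ψ q).1.1 := by
  rintro ⟨ψ, hψ, hadj⟩
  have hmem : ∀ q : ↥D, (ψ q).1.1 ∈ N := fun q => hN q.1 q.2 _ (ψ q).1.2 (hadj q)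
  let ψ' : ↥D → ↥N × Fin 6 := fun q => (⟨(ψ q).1.1, hmem q⟩, (ψ q).2)
  have hψ' : Function.Injective ψ' := by
    intro q q' hqq'
    apply hψ
    have h1 : (ψ q).1.1 = (ψ q').1.1 := congrArg (fun x => x.1.1) hqq'
    have h2 : (ψ q).2 = (ψ q').2 := congrArg (fun x => x.2) hqq'
    exact Prod.ext (Subtype.ext h1) h2
  have hc := Fintype.card_le_of_injective ψ' hψ'
  rw [Fintype.card_prod, Fintype.card_fin, Fintype.card_coe, Fintype.card_coe] at hc
  omega

/-- Every slot adjacent to a bad partition of the witness lies in `csN` (by the definition of `csN`). [this work] -/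
theorem mem_csN_of_adj : ∀ q ∈ csF.badParts, ∀ s ∈ csF.slotParts, csF.LMAdj q s → s ∈ csN := by
  intro q hq s hs h
  unfold csN
  rw [Finset.mem_biUnion]
  exact ⟨q, hq, Finset.mem_filter.2 ⟨hs, h⟩⟩

end LocalMatchingRefutation

attribute [local irreducible] LocalMatchingRefutation.csV LocalMatchingRefutation.csA LocalMatchingRefutation.csF LocalMatchingRefutation.csN in
open LocalMatchingRefutation in
/-- **The fixed-spectator local matching conjecture is FALSE** (six points, three petals): the witness `csF` admits no injective `LMAdj`-respecting assignment
`badParts → slotParts × Fin 6`, since all its bad partitions together are adjacent to only 37 slots while `#badParts = 228 > 6 · 37`. [this work] -/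
theorem not_localMatchingK : ¬ LocalMatchingK := by
  intro h
  have key : ∃ ψ : ↥csF.badParts → ↥csF.slotParts × Fin 6, Function.Injective ψ ∧ ∀ q, csF.LMAdj q.1 (ψ q).1.1 :=
    h 3 (Fin 6) csF
  exact no_injective_of_small_neighbourhood csF.badParts csF.slotParts csN csF.LMAdj mem_csN_of_adj six_mul_card_csN_lt key

end Summit.CriticalPhenomena.PercolationContinuityZ3.Theorems.SunflowerPartition
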